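import Summits.ValiantsHypothesis.ValiantsHypothesis.Theorems.FifoMatchingGridCorShadowExpRung
import Summits.ValiantsHypothesis.ValiantsHypothesis.Theses.FifoMatching
import HarnessLib

/-!
# R2-exp: the support item `NNExpDegreeCofactorHard` (stmt-ValiantsHypothesis-27406) holds

The route `ValiantsHypothesis/FifoMatching` support item R2-exp `NNExpDegreeCofactorHard` (tenure g12 2026-08-28T10:14Z per
director-valiant g13 R207 (a)): eventually in `n`, for every nonzero cofactor `h` over `ℝ≥0` of total degree
`≤ 2^{⌊n^{1/8}⌋}`, `2^{⌊n^{1/8}⌋} < L₊(NN_n · h)` (`⌊n^{1/8}⌋ := Nat.sqrt (Nat.sqrt (Nat.sqrt n))`; `NN_n` inlined as in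
23918/27271, definitionally the library's `nestFreeMatchingPoly n ℝ≥0`).

PROVED: `exact` the Theorems-side port `GridCorShadow.expRung_holds` (`Theorems/FifoMatchingGridCorShadowExpRung.lean`,
val-port-2 g1; mathematics = val-idea-7 g7's line `Cruxes/NNLinearDegreeCofactorHard/Lines/shadow_division.lean` rev 10
§ExpRung): the located faces of the shadow line — G♭ = item 27045 `gridCorCliqueFace_holds` (AFHMS 2019 in the tree, val-lit
p10 g2 / p9 g1 / p4 g12, closer val-port-4 g1) and A1 `GridCorShadow.queueGridZeroOnePoints_holds` (val-port-4 g1 over qg1 g0's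
gadget) — give `σ(NFP_n) ≥ 2^{Ω(√n)}` shadow vertices (HY21 Prop 19 parabola shadow + Lemma 10 face lifts, port-2 g0 F1–F4,
port-2 g1 F6/F9a), and HY21 Thm 42 with the BCS balancing theorem (`formulaComplexity_le_two_pow`) turns that into monotone
hardness `2^{n^{1/8}}` of every multiple `NN_n · h`, `deg h ≤ 2^{n^{1/8}}` (F5, F9b).

LADDER / HONEST FRAME: a SUPPORT rung of route FifoMatching, strictly above R2 = 27271 (closed) and strictly below the residual
21181 `NNDivisionHard` (open; residual N2♯); `NNNotVP` untouched; VP ≠ VNP is NOT proved; nothing here is a summit statement.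
-/

-- Sub = Summit single-conjunct layout: the duplicated namespace component is mandated by the tree.
set_option linter.dupNamespace false

namespace Summit.ValiantsHypothesis.ValiantsHypothesis.Theorems.FifoMatching

/-- **Item stmt-ValiantsHypothesis-27406 `NNExpDegreeCofactorHard` — proved** (exact type of the route decl): eventually in
`n`, `2^{⌊n^{1/8}⌋} < L₊(NN_n · h)` for every nonzero cofactor `h` of total degree `≤ 2^{⌊n^{1/8}⌋}`.
[cite: HrubesYehudayoff2021, Prop 43(2)/Rem 20 with Prop 19, Lemma 10, Thm 42] [cite: AboulkerEtAl2019, Thm 6 (pp. 5–6)] -/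
theorem nnExpDegreeCofactorHard_holds :
    Summit.ValiantsHypothesis.ValiantsHypothesis.Theses.FifoMatching.NNExpDegreeCofactorHard :=
  GridCorShadow.expRung_holds

end Summit.ValiantsHypothesis.ValiantsHypothesis.Theorems.FifoMatching
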